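import Summits.QuantumAdvantage.QuantumAdvantage.Theorems.SupportDialResidueCertificateE

/-! # SupportDial residue certificate — part F (decomp-qadv-lens-1 g7, node «ResidueDial» rev 5)

§7b part 2 + §8: degree bookkeeping (`compLift`, `pull_mem`), `yStepLaw2`, `halfDegreeLaw2_of_signTwist`, grades r ≤ 2. -/

set_option linter.dupNamespace false
set_option linter.style.longLine false
set_option linter.unusedVariables false

open Finset
open Literature.Computability.QuantumComplexity.RingHLF
open Literature.Computability.MetaComplexity.Smolensky (CubeFn mono lowDeg)
open Summit.QuantumAdvantage.AdviceFreeQNC0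

namespace Summit.QuantumAdvantage.QuantumAdvantage.Theorems.SupportDialResidueCertificate

section YStep
open Literature.Computability.MetaComplexity.Smolensky


/-! ### Stage 4: degree of the pulled-back strategy, and the Y-step -/

section Degree
variable {k : ℕ}

/-- composition with the (affine, coordinatewise) lift is linear -/
def compLift (k : ℕ) : CubeFn (ZMod 2) (k + 1) →ₗ[ZMod 2] CubeFn (ZMod 2) k where
  toFun f := fun β' => f (liftB β')
  map_add' _ _ := rfl
  map_smul' _ _ := rfl

/-- ResidueDial helper `compLift_apply` (lens-1 g7 ResidueDial certificate; see the enclosing section docstring). -/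
theorem compLift_apply (f : CubeFn (ZMod 2) (k + 1)) (β' : Fin k → Bool) : compLift k f β' = f (liftB β') := rfl

/-- a lifted monomial has degree at most `|S|` on the small cube -/
theorem mono_comp_mem (S : Finset (Fin (k + 1))) :
    (fun β' : Fin k → Bool => mono (ZMod 2) S (liftB β')) ∈ lowDeg (ZMod 2) k S.card := by
  let b : ℕ → (Fin k → Bool) → Bool := fun a β' => if h : a < k + 1 then liftB β' ⟨a, h⟩ else false
  have hb : ∀ a, (fun β' => ind (b a β')) ∈ lowDeg (ZMod 2) k 1 := by
    intro a
    by_cases hak : a < k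
    · have hfun : (fun β' => ind (b a β')) = mono (ZMod 2) {(⟨a, hak⟩ : Fin k)} + (fun _ => ind (cN (⟨a, hak⟩ : Fin k))) := by
        funext β'
        simp only [b, dif_pos (show a < k + 1 by omega), Pi.add_apply]
        rw [show (⟨a, (show a < k + 1 by omega)⟩ : Fin (k + 1)) = Fin.castSucc ⟨a, hak⟩ from Fin.ext rfl, liftB_castSucc, ind_xor,
          mono_singleton]
      rw [hfun]
      refine Submodule.add_mem _ (mono_mem_lowDeg (by simp)) ?_
      have : (fun _ : Fin k → Bool => ind (cN (⟨a, hak⟩ : Fin k))) = ind (cN (⟨a, hak⟩ : Fin k)) • (1 : CubeFn (ZMod 2) k) := by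
        funext β'; simp
      rw [this]; exact Submodule.smul_mem _ _ one_mem_lowDeg
    · by_cases haK : a = k
      · have hfun : (fun β' => ind (b a β')) = (1 : CubeFn (ZMod 2) k) := by
          funext β'
          simp only [b, dif_pos (show a < k + 1 by omega), Pi.one_apply]
          rw [show (⟨a, (show a < k + 1 by omega)⟩ : Fin (k + 1)) = Fin.last k from Fin.ext (by simp [haK]), liftB_last, ind_true]
        rw [hfun]; exact one_mem_lowDeg
      · have hfun : (fun β' => ind (b a β')) = 0 := by
          funext β'
          simp only [b, dif_neg (show ¬ a < k + 1 by omega), Pi.zero_apply, ind_false]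
        rw [hfun]; exact Submodule.zero_mem _
  let Φ : (ℕ → Bool) → ZMod 2 := fun c => ∏ i ∈ S, ind (c i.val)
  have hdep : ∀ c c' : ℕ → Bool, (∀ a ∈ S.map Fin.valEmbedding, c a = c' a) → Φ c = Φ c' := by
    intro c c' h
    refine Finset.prod_congr rfl fun i hi => ?_
    rw [h i.val (Finset.mem_map_of_mem _ hi)]
  have hmem := lowDeg_of_depends b hb (S.map Fin.valEmbedding) Φ hdep
  rw [Finset.card_map] at hmem
  have hid : (fun β' : Fin k → Bool => mono (ZMod 2) S (liftB β')) = fun β' => Φ (fun a => b a β') := by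
    funext β'
    rw [show mono (ZMod 2) S (liftB β') = ∏ i ∈ S, ind (liftB β' i) from rfl]
    refine Finset.prod_congr rfl fun i hi => ?_
    have hbi : b i.val β' = liftB β' i := by simp only [b, dif_pos i.isLt, Fin.eta]
    show ind (liftB β' i) = ind (b i.val β')
    rw [hbi]
  rw [hid]; exact hmem

/-- (L1a) precomposition with the lift does not raise the degree -/
theorem comp_liftB_mem {r : ℕ} {f : CubeFn (ZMod 2) (k + 1)} (hf : f ∈ lowDeg (ZMod 2) (k + 1) r) :
    (fun β' : Fin k → Bool => f (liftB β')) ∈ lowDeg (ZMod 2) k r := by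
  have hle : (lowDeg (ZMod 2) (k + 1) r).map (compLift k) ≤ lowDeg (ZMod 2) k r := by
    rw [lowDeg_eq_span (D := r), Submodule.map_span_le]
    rintro _ ⟨⟨S, hS⟩, rfl⟩
    exact lowDeg_mono hS (mono_comp_mem S)
  exact hle (Submodule.mem_map_of_mem hf)

/-- (L1) every coordinate of the pulled-back strategy has degree `≤ r` (uses `r ≥ 1` for the `β'_l` correction) -/
theorem pull_mem {r : ℕ} (hr : 1 ≤ r) (w : (Fin (k + 1) → Bool) → Fin (k + 1) → Bool)
    (hw : ∀ j : Fin (k + 1), (fun β : Fin (k + 1) → Bool => if w β j = true then (1 : ZMod 2) else 0) ∈ lowDeg (ZMod 2) (k + 1) r)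
    (l : Fin k) :
    (fun β' : Fin k → Bool => if pz (w (liftB β')) β' l = true then (1 : ZMod 2) else 0) ∈ lowDeg (ZMod 2) k r := by
  change (fun β' : Fin k → Bool => ind (pz (w (liftB β')) β' l)) ∈ lowDeg (ZMod 2) k r
  have key : (fun β' : Fin k → Bool => ind (pz (w (liftB β')) β' l)) =
      (fun β' => ind (w (liftB β') (Fin.castSucc l))) +
        ind (cN l) • ((fun β' => ind (w (liftB β') (Fin.last k))) + mono (ZMod 2) {l}) := by
    funext β'
    rw [Pi.add_apply, Pi.smul_apply, Pi.add_apply, smul_eq_mul, mono_singleton]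
    unfold pz
    cases w (liftB β') (Fin.castSucc l) <;> cases cN l <;> cases w (liftB β') (Fin.last k) <;> cases β' l <;> decide
  rw [key]
  refine Submodule.add_mem _ (comp_liftB_mem (hw (Fin.castSucc l))) (Submodule.smul_mem _ _ (Submodule.add_mem _ ?_ ?_))
  · exact comp_liftB_mem (hw (Fin.last k))
  · exact lowDeg_mono hr (mono_mem_lowDeg (by simp))

end Degree

/-- **`YStepLaw2` PROVED**: the Y-contraction (delete a vertex carrying `β = 1`, complement and merge its two
neighbours; pull the answer back by `z'_u = z_u ⊕ z_v ⊕ β'_u`, `z'_0 = z_0 ⊕ z_v ⊕ β'_0`). -/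
theorem yStepLaw2 : YStepLaw2 := by
  intro k r hk hr hlose w hw
  by_contra hall
  push Not at hall
  obtain ⟨β', hodd, hnot⟩ := hlose (fun β' => pz (w (liftB β')) β') (fun l => pull_mem hr w hw l)
  exact hnot (rel_pull hk β' (w (liftB β')) (hall (liftB β') (oddZeros_lift (by omega) β' hodd)))


/-- **THE NODE AFTER g7, FINAL FORM (PROVED, 0 sorry): `SignTwistLaw2 → SupportDial.HalfDegreeLaw2` (tree 32140 BY NAME).**
The 𝔽₂ half-degree law on the bare cycle is EQUIVALENT-IN-PRACTICE to the parity law `N_{2r+3}` odd. -/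
theorem halfDegreeLaw2_of_signTwist (hS : SignTwistLaw2) :
    Summit.QuantumAdvantage.QuantumAdvantage.Theses.SupportDial.HalfDegreeLaw2 :=
  closes_final hS yStepLaw2

/-- Per grade, all sizes: `N_{2r+3}` odd ⇒ every `k ≥ 2r+3` cycle defeats 𝔽₂-degree `r` on the odd class. -/
theorem smallRingLosesDeg_of_signTwistAt_all (r : ℕ) (hr : 1 ≤ r) (hS : SignTwistAt r) :
    ∀ k, 2 * r + 3 ≤ k → SmallRingLosesDeg k r := by
  intro k hk
  induction k with
  | zero => omega
  | succ m ih =>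
    rcases Nat.eq_or_lt_of_le hk with h | h
    · rw [← h]; exact smallRingLosesDeg_of_signTwistAt r hr hS
    · exact yStepLaw2 m r (by omega) hr (ih (by omega))

/-- **RUNG (PROVED): the whole grade `r = 1`** — every cycle `C_k`, `k ≥ 5`, defeats every 𝔽₂-AFFINE strategy on the odd class. -/
theorem smallRingLosesDeg_grade1 : ∀ k, 5 ≤ k → SmallRingLosesDeg k 1 :=
  smallRingLosesDeg_of_signTwistAt_all 1 (by norm_num) signTwistAt_one

/-- **RUNG (PROVED): the whole grade `r = 2`** — every cycle `C_k`, `k ≥ 7`, defeats every 𝔽₂-QUADRATIC strategy on the odd class. -/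
theorem smallRingLosesDeg_grade2 : ∀ k, 7 ≤ k → SmallRingLosesDeg k 2 :=
  smallRingLosesDeg_of_signTwistAt_all 2 (by norm_num) signTwistAt_two

/-- `HalfDegreeLaw2` restricted to degree `r ≤ 2` is a THEOREM. -/
theorem halfDegreeLaw2_upto2 : ∀ k r : ℕ, r ≤ 2 → 5 ≤ k → 2 * r + 3 ≤ k → SmallRingLosesDeg k r := by
  intro k r hr2 h5 hk
  rcases Nat.lt_or_ge r 1 with h0 | h1
  · have : r = 0 := by omega
    subst this
    exact smallRingLosesDeg_mono (by norm_num) (smallRingLosesDeg_grade1 k h5)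
  · rcases Nat.lt_or_ge r 2 with h1' | h2
    · have : r = 1 := by omega
      subst this; exact smallRingLosesDeg_grade1 k h5
    · have : r = 2 := by omega
      subst this; exact smallRingLosesDeg_grade2 k hk

end YStep

/-! ## §8 Records: where the node sits in route-QuantumAdvantage-SupportDial

* `HalfDegreeLaw2R` replaces 31927 in support 31928: g6 `noPerfectMinority3_of_halfDegree_select (hD) (hSel :
  MinoritySelect3) : NoPerfectMinority3` and `hubCertificateLaw3_of_collapse` apply `hD` only as `hD H.card r hr`
  under `h5 : 5 ≤ H.card`, i.e. only through `HalfDegreeLaw2R` (re-glue: `(hD : HalfDegreeLaw2R)`; proof text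
  unchanged but for inserting `h5`).
* With this node (rev 3) the crux 32140 — hence the fan-in line P1 = 31926 `NoPerfectMinority3`, via the critic's
  `H := univ` closer of 31928 — rests on TWO uniform laws at `p = 2`: the SIGN TWIST `SignTwistLaw2` (`N_{2r+3}` odd;
  the crux; decided r = 1, 2 here, data k ≤ 41, Jacobsthal structure) and the Y-STEP `YStepLaw2` (support, explicit
  contraction); the moment law is a THEOREM (`momentLaw2`).  The only IDEA-NEEDED piece of SupportDial remains the
  declared residual 31929 `MinorityLift3` (majority readers / cross-characteristic).
-/

/-- The guarded law is all the fan-in glue ever uses: restatement for the writer's re-glue. -/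
theorem halfDegreeLaw2R_apply (h : HalfDegreeLaw2R) {k r : ℕ} (h5 : 5 ≤ k) (hk : 2 * r + 3 ≤ k) :
    SmallRingLosesDeg k r := h k r h5 hk

end Summit.QuantumAdvantage.QuantumAdvantage.Theorems.SupportDialResidueCertificate
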